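import Mathlib
import Summits.CriticalPhenomena.CardyFormulaZ2.Theorems.CardySelfRefinementDefs
import Summits.CriticalPhenomena.CardyFormulaZ2.Theorems.CardySelfRefinementTrivialSectorRateStubRussoOrbit
import Summits.CriticalPhenomena.CardyFormulaZ2.Theorems.CardySelfRefinementTrivialSectorRateStubPivotalMassDictionary
import Summits.CriticalPhenomena.CardyFormulaZ2.Theorems.CardySelfRefinementTrivialSectorRateStubPivotalMassRelevance
import Summits.CriticalPhenomena.CardyFormulaZ2.Theorems.CardySelfRefinementTrivialSectorRateStubFarFieldFactorisation
import Summits.CriticalPhenomena.CardyFormulaZ2.Theorems.CardySelfRefinementTrivialSectorRateStubFourArmAboveOneExplorerAssembly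
import HarnessLib

/-!
# Route CardySelfRefinement — `TrivialSectorRateOfSplit`: the glue of the strategist's decomposition of the
# crux `TrivialSectorRate` (stmt-CriticalPhenomena-10266) into `BlockAlignment` (ENGINE) and `BoundaryRelevance` (HB)

Strategist `planner-cstrat-stmt-CriticalPhenomena-10266-s2-0`, 2026-08-17.  The two split children are, VERBATIM,
the two registered open stubs of the live line `far-field-is-a-quarter-turn` (skeleton r5,
`Cruxes/TrivialSectorRate/Lines/far_field_is_a_quarter_turn.lean`, leads c2–c7): `stub_blockAlignment` (the engine:
`C₄`-orbit-summed Russo responses of a block forget the far field at relative rate `1/R`) and `stub_boundaryRelevance`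
((HB): boundary relevance mass above one at every inner scale).  In the ROUTE FILE the children are typed in the route's
own `let`-chain vocabulary (the `FarField` vocabulary of `Theorems/CardySelfRefinementDefs.lean` inlined; `IsPivotalOn`
inlined because `Literature.Probability.Percolation.PivotalCell` is outside the Theses import cone); they unfold to the
`FarField` forms below by `δ`/`ζ`-reduction only (`blockAlignment_iff`, `boundaryRelevance_iff` are `Iff.rfl`).

THE GLUE `TrivialSectorRate_of_subs : BlockAlignment → BoundaryRelevance → TrivialSectorRate` is the skeleton's
kernel-checked composition `TrivialSectorRate_of` (§5b–§5c of skeleton r5, lead c2; reproduced verbatim below — per-block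
bound `perBlockR` at contact radius `8kR₀`, summed over the Russo–orbit block set against the weighted relevance mass
`weightedRelevanceMass_of_factorisation` (p117313), with the PROVED inputs `FarField.stub_russoOrbit` (p98986),
`FarField.stub_fourArmAboveOne` (p123868), `FarField.stub_farFieldFactorisation` (p114970) discharged by name; `θ := a`).

LANDING INSTRUCTIONS (prover; planners cannot write under Theorems/): once the gate has rendered the split
(route decls `Theses.CardySelfRefinement.BlockAlignment`, `.BoundaryRelevance`, glue item `.TrivialSectorRateOfSplit`),
DELETE §0 below (the stand-ins then clash with the route decls — they are character-for-character the filed statements)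
and land this file as `Theorems/CardySelfRefinementTrivialSectorRateOfSplit.lean` closing the glue item with
`theorem trivialSectorRateOfSplit_proof : TrivialSectorRateOfSplit := TrivialSectorRate_of_subs` (§3, last line).
`lean check`: rc 0, 0 sorry, axioms propext / Classical.choice / Quot.sound.
-/

noncomputable section

/-! ## §0 STAND-INS for the route-context children (DELETE after the split is rendered; verbatim the filed statements) -/

namespace Summit.CriticalPhenomena.CardyFormulaZ2.Theses.CardySelfRefinement

open scoped BigOperators Topology Manifold Classical MeasureTheory ProbabilityTheory Matrix InnerProductSpace ComplexConjugate ContinuousMap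
open Filter Set Function TopologicalSpace MeasureTheory

/-- split child 1 of `TrivialSectorRate` (route-context rendering; = registered `stub_blockAlignment`). -/
def BlockAlignment : Prop :=
  let ax : ℕ → Literature.Probability.LatticeModels.Site 2 × Fin 2 → Prop := fun k e => (k : ℤ) ∣ e.1 (if e.2 = 0 then 1 else 0); let tb : ℕ → Literature.Probability.LatticeModels.Site 2 × Fin 2 → Literature.Probability.LatticeModels.Site 2 := fun k e i => e.1 i / (k : ℤ); let opn : ℕ → Set (Literature.Probability.LatticeModels.Site 2 × Fin 2 × Fin 3) → Literature.Probability.LatticeModels.Site 2 × Fin 2 → Prop := fun k S e => if ax k e then ((tb k e, e.2, (2 : Fin 3)) ∈ S ∧ (tb k e, e.2, (1 : Fin 3)) ∈ S) ∨ ((tb k e, e.2, (2 : Fin 3)) ∉ S ∧ (e.1, e.2, (0 : Fin 3)) ∈ S) else (e.1, e.2, (0 : Fin 3)) ∈ S; let cfg : ℕ → Set (Literature.Probability.LatticeModels.Site 2 × Fin 2 × Fin 3) → Literature.Probability.Percolation.BondConfig (Literature.Probability.LatticeModels.Site 2) := fun k S => {e | ∃ (v : Literature.Probability.LatticeModels.Site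 2) (d : Fin 2), e = s(v, v + (if d = 0 then ![1, 0] else ![0, 1])) ∧ opn k S (v, d)}; let prm : ℕ → ℝ → ℝ → Literature.Probability.LatticeModels.Site 2 × Fin 2 × Fin 3 → unitInterval := fun k ρ c i => if i.2.2 = 0 then (if ax k (i.1, i.2.1) then Literature.Probability.Percolation.half else Set.projIcc (0 : ℝ) 1 zero_le_one c) else if i.2.2 = 1 then Literature.Probability.Percolation.half else Set.projIcc (0 : ℝ) 1 zero_le_one ρ; let M : ℕ → ℝ → ℝ → MeasureTheory.Measure (Literature.Probability.Percolation.BondConfig (Literature.Probability.LatticeModels.Site 2)) := fun k ρ c => (Literature.Probability.LatticeModels.prodBernoulli (prm k ρ c)).map (cfg k); let A : (m : ℕ) → (Fin m → Literature.Probability.Percolation.QuadCrossing.Quad (Set.univ : Set ℂ)) → ℝ → Set (Literature.Probability.Percolation.BondConfig (Literature.Probability.LatticeModels.Site 2)) := fun m F η => {ω | ∀ i, F i ∈ Literature.Probability.Percolation.QuadCrossing.configOf Literature.Probability.LatticeModels.squareLatticeEmbedding.z η Set.univ ω}; let PathOK : ℕ → (unitInterval → ℝ × ℝ) → Prop :=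 fun k γ => Continuous γ ∧ γ 0 = (1, 0) ∧ γ 1 = (0, 1 / 2) ∧ (∀ s, γ s ∈ Set.Icc (0 : ℝ) 1 ×ˢ Set.Icc (0 : ℝ) 1) ∧ BoundedVariationOn (fun s => (γ s).1) Set.univ ∧ BoundedVariationOn (fun s => (γ s).2) Set.univ ∧ ∀ a : ℝ, 0 < a → ∃ c₀ > 0, ∃ n₀ : ℕ, ∀ s, Literature.Probability.LatticeModels.BoxCrossingBounds (M k (γ s).1 (γ s).2) Literature.Probability.LatticeModels.squareLatticeEmbedding.z a c₀ n₀; let pairsNear : ℝ → Set ℂ → Set (Sym2 (Literature.Probability.LatticeModels.Site 2)) := fun η B => {e | ∃ x y : Literature.Probability.LatticeModels.Site 2, e = s(x, y) ∧ (segment ℝ ((η : ℂ) * Literature.Probability.LatticeModels.squareLatticeEmbedding.z x) ((η : ℂ) * Literature.Probability.LatticeModels.squareLatticeEmbedding.z y) ∩ B).Nonempty}; let edgesNear : ℝ → Set ℂ → Set (Sym2 (Literature.Probability.LatticeModels.Site 2)) := fun η B => pairsNear η B ∩ (Literature.Probability.LatticeModels.zdGraph 2).edgeSet; let window : (m : ℕ)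 → (Fin m → Literature.Probability.Percolation.QuadCrossing.Quad (Set.univ : Set ℂ)) → ℝ → Set (Sym2 (Literature.Probability.LatticeModels.Site 2)) := fun m F η => ⋃ i, edgesNear η (Metric.thickening 1 (F i).carrier); let Aloc : (m : ℕ) → (Fin m → Literature.Probability.Percolation.QuadCrossing.Quad (Set.univ : Set ℂ)) → ℝ → Set (Literature.Probability.Percolation.BondConfig (Literature.Probability.LatticeModels.Site 2)) := fun m F η => {ω | ω ∩ window m F η ∈ A m F η}; let coinEvent : ℕ → (m : ℕ) → (Fin m → Literature.Probability.Percolation.QuadCrossing.Quad (Set.univ : Set ℂ)) → ℝ → Set (Set (Literature.Probability.LatticeModels.Site 2 × Fin 2 × Fin 3)) := fun k m F η => (cfg k) ⁻¹' Aloc m F η; let coinLaw : ℕ → ℝ × ℝ → MeasureTheory.Measure (Set (Literature.Probability.LatticeModels.Site 2 × Fin 2 × Fin 3)) := fun k q => Literature.Probability.LatticeModels.prodBernoulli (prm k q.1 q.2); let infl : ℕ → (m : ℕ) → (Fin m → Literature.Probability.Percolation.QuadCrossing.Quad (Set.univ : Set ℂ)) → ℝ → ℝ × ℝ → Literature.Probability.LatticeModels.Site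 2 × Fin 2 × Fin 3 → ℝ := fun k m F η q i => (coinLaw k q).real {S | insert i S ∈ coinEvent k m F η} - (coinLaw k q).real {S | S \ {i} ∈ coinEvent k m F η}; let ctr : ℕ → Literature.Probability.LatticeModels.Site 2 → Literature.Probability.LatticeModels.Site 2 := fun k u i => (k : ℤ) * u i; let bundlesAt : Literature.Probability.LatticeModels.Site 2 → Finset (Literature.Probability.LatticeModels.Site 2 × Fin 2) := fun u => {(u, 0), (u, 1), (u - Pi.single 0 1, 0), (u - Pi.single 1 1, 1)}; let cellsAt : Literature.Probability.LatticeModels.Site 2 → Finset (Literature.Probability.LatticeModels.Site 2) := fun u => {u, u - Pi.single 0 1, u - Pi.single 1 1, u - Pi.single 0 1 - Pi.single 1 1}; let interiorEdges : ℕ → Literature.Probability.LatticeModels.Site 2 → Finset (Literature.Probability.LatticeModels.Site 2 × Fin 2) := fun k t => ((Finset.univ : Finset (Fin k × Fin k × Fin 2)).image (fun p => ((fun i => (k : ℤ) * t i + (![((p.1 : ℕ) : ℤ), ((p.2.1 : ℕ) : ℤ)] : Literature.Probability.LatticeModels.Site 2) i), p.2.2))).filter (fun e => ¬ ax k e); let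 Tρ : ℕ → (m : ℕ) → (Fin m → Literature.Probability.Percolation.QuadCrossing.Quad (Set.univ : Set ℂ)) → ℝ → ℝ × ℝ → Literature.Probability.LatticeModels.Site 2 → ℝ := fun k m F η q u => (1 / 2 : ℝ) * ∑ b ∈ bundlesAt u, infl k m F η q (b.1, b.2, (2 : Fin 3)); let Tc : ℕ → (m : ℕ) → (Fin m → Literature.Probability.Percolation.QuadCrossing.Quad (Set.univ : Set ℂ)) → ℝ → ℝ × ℝ → Literature.Probability.LatticeModels.Site 2 → ℝ := fun k m F η q u => (1 / 4 : ℝ) * ∑ t ∈ cellsAt u, ∑ e ∈ interiorEdges k t, infl k m F η q (e.1, e.2, (0 : Fin 3)); let quadBdry : (m : ℕ) → (Fin m → Literature.Probability.Percolation.QuadCrossing.Quad (Set.univ : Set ℂ)) → Set ℂ := fun m F => ⋃ i, frontier (Set.range (F i)); let bdist : ℕ → (m : ℕ) → (Fin m → Literature.Probability.Percolation.QuadCrossing.Quad (Set.univ : Set ℂ)) → ℝ → Literature.Probability.LatticeModels.Site 2 → ℝ := fun k m F η u => Metric.infDist ((η : ℂ) * Literature.Probability.LatticeModels.squareLatticeEmbedding.z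 (ctr k u)) (quadBdry m F); let boxEdgesAt : Literature.Probability.LatticeModels.Site 2 → ℕ → Set (Sym2 (Literature.Probability.LatticeModels.Site 2)) := fun c R => {e | e ∈ (Literature.Probability.LatticeModels.zdGraph 2).edgeSet ∧ ∀ v ∈ e, v - c ∈ Literature.Probability.LatticeModels.box 2 R}; let Rel : ℕ → (m : ℕ) → (Fin m → Literature.Probability.Percolation.QuadCrossing.Quad (Set.univ : Set ℂ)) → ℝ → Literature.Probability.LatticeModels.Site 2 → ℕ → Set (Literature.Probability.Percolation.BondConfig (Literature.Probability.LatticeModels.Site 2)) := fun k m F η u R => {ω | ∃ ω' : Literature.Probability.Percolation.BondConfig (Literature.Probability.LatticeModels.Site 2), (∀ i, i ∉ boxEdgesAt (ctr k u) R → (i ∈ ω' ↔ i ∈ ω)) ∧ ¬ (ω' ∈ Aloc m F η ↔ ω ∈ Aloc m F η)}; ∀ k : ℕ, k = 2 ∨ k = 3 → ∀ γ : unitInterval → ℝ × ℝ, PathOK k γ → ∃ κ₁ κ₂ : unitInterval → ℝ, Continuous κ₁ ∧ Continuous κ₂ ∧ (∀ s, κ₁ s ≠ 0 ∨ κ₂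 s ≠ 0) ∧ ∃ (C : ℝ) (R₀ : ℕ), 0 ≤ C ∧ 1 ≤ R₀ ∧ ∀ (s : unitInterval) (η : ℝ), 0 < η → ∀ (m : ℕ) (F : Fin m → Literature.Probability.Percolation.QuadCrossing.Quad (Set.univ : Set ℂ)) (u : Literature.Probability.LatticeModels.Site 2) (R : ℕ), R₀ ≤ R → k ∣ R → 4 * η * R < bdist k m F η u → |κ₂ s * Tρ k m F η (γ s) u - κ₁ s * Tc k m F η (γ s) u| ≤ C / R * (M k (γ s).1 (γ s).2).real (Rel k m F η u k)

/-- split child 2 of `TrivialSectorRate` (route-context rendering; = registered `stub_boundaryRelevance`). -/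
def BoundaryRelevance : Prop :=
  let ax : ℕ → Literature.Probability.LatticeModels.Site 2 × Fin 2 → Prop := fun k e => (k : ℤ) ∣ e.1 (if e.2 = 0 then 1 else 0); let tb : ℕ → Literature.Probability.LatticeModels.Site 2 × Fin 2 → Literature.Probability.LatticeModels.Site 2 := fun k e i => e.1 i / (k : ℤ); let opn : ℕ → Set (Literature.Probability.LatticeModels.Site 2 × Fin 2 × Fin 3) → Literature.Probability.LatticeModels.Site 2 × Fin 2 → Prop := fun k S e => if ax k e then ((tb k e, e.2, (2 : Fin 3)) ∈ S ∧ (tb k e, e.2, (1 : Fin 3)) ∈ S) ∨ ((tb k e, e.2, (2 : Fin 3)) ∉ S ∧ (e.1, e.2, (0 : Fin 3)) ∈ S) else (e.1, e.2, (0 : Fin 3)) ∈ S; let cfg : ℕ → Set (Literature.Probability.LatticeModels.Site 2 × Fin 2 × Fin 3) → Literature.Probability.Percolation.BondConfig (Literature.Probability.LatticeModels.Site 2) := fun k S => {e | ∃ (v : Literature.Probability.LatticeModels.Site 2) (d : Fin 2), e = s(v, v + (if d = 0 then ![1, 0] else ![0, 1])) ∧ opn k S (v, d)}; let prm : ℕ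 → ℝ → ℝ → Literature.Probability.LatticeModels.Site 2 × Fin 2 × Fin 3 → unitInterval := fun k ρ c i => if i.2.2 = 0 then (if ax k (i.1, i.2.1) then Literature.Probability.Percolation.half else Set.projIcc (0 : ℝ) 1 zero_le_one c) else if i.2.2 = 1 then Literature.Probability.Percolation.half else Set.projIcc (0 : ℝ) 1 zero_le_one ρ; let M : ℕ → ℝ → ℝ → MeasureTheory.Measure (Literature.Probability.Percolation.BondConfig (Literature.Probability.LatticeModels.Site 2)) := fun k ρ c => (Literature.Probability.LatticeModels.prodBernoulli (prm k ρ c)).map (cfg k); let A : (m : ℕ) → (Fin m → Literature.Probability.Percolation.QuadCrossing.Quad (Set.univ : Set ℂ)) → ℝ → Set (Literature.Probability.Percolation.BondConfig (Literature.Probability.LatticeModels.Site 2)) := fun m F η => {ω | ∀ i, F i ∈ Literature.Probability.Percolation.QuadCrossing.configOf Literature.Probability.LatticeModels.squareLatticeEmbedding.z η Set.univ ω}; let PathOK : ℕ → (unitInterval → ℝ × ℝ) → Prop := fun k γ => Continuous γ ∧ γ 0 = (1, 0) ∧ γ 1 = (0, 1 / 2) ∧ (∀ s, γ s ∈ Set.Icc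 (0 : ℝ) 1 ×ˢ Set.Icc (0 : ℝ) 1) ∧ BoundedVariationOn (fun s => (γ s).1) Set.univ ∧ BoundedVariationOn (fun s => (γ s).2) Set.univ ∧ ∀ a : ℝ, 0 < a → ∃ c₀ > 0, ∃ n₀ : ℕ, ∀ s, Literature.Probability.LatticeModels.BoxCrossingBounds (M k (γ s).1 (γ s).2) Literature.Probability.LatticeModels.squareLatticeEmbedding.z a c₀ n₀; let pairsNear : ℝ → Set ℂ → Set (Sym2 (Literature.Probability.LatticeModels.Site 2)) := fun η B => {e | ∃ x y : Literature.Probability.LatticeModels.Site 2, e = s(x, y) ∧ (segment ℝ ((η : ℂ) * Literature.Probability.LatticeModels.squareLatticeEmbedding.z x) ((η : ℂ) * Literature.Probability.LatticeModels.squareLatticeEmbedding.z y) ∩ B).Nonempty}; let edgesNear : ℝ → Set ℂ → Set (Sym2 (Literature.Probability.LatticeModels.Site 2)) := fun η B => pairsNear η B ∩ (Literature.Probability.LatticeModels.zdGraph 2).edgeSet; let window : (m : ℕ) → (Fin m → Literature.Probability.Percolation.QuadCrossing.Quad (Set.univ : Set ℂ)) → ℝ → Set (Sym2 (Literature.Probability.LatticeModels.Site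 2)) := fun m F η => ⋃ i, edgesNear η (Metric.thickening 1 (F i).carrier); let Aloc : (m : ℕ) → (Fin m → Literature.Probability.Percolation.QuadCrossing.Quad (Set.univ : Set ℂ)) → ℝ → Set (Literature.Probability.Percolation.BondConfig (Literature.Probability.LatticeModels.Site 2)) := fun m F η => {ω | ω ∩ window m F η ∈ A m F η}; let ctr : ℕ → Literature.Probability.LatticeModels.Site 2 → Literature.Probability.LatticeModels.Site 2 := fun k u i => (k : ℤ) * u i; let quadBdry : (m : ℕ) → (Fin m → Literature.Probability.Percolation.QuadCrossing.Quad (Set.univ : Set ℂ)) → Set ℂ := fun m F => ⋃ i, frontier (Set.range (F i)); let bdist : ℕ → (m : ℕ) → (Fin m → Literature.Probability.Percolation.QuadCrossing.Quad (Set.univ : Set ℂ)) → ℝ → Literature.Probability.LatticeModels.Site 2 → ℝ := fun k m F η u => Metric.infDist ((η : ℂ) * Literature.Probability.LatticeModels.squareLatticeEmbedding.z (ctr k u)) (quadBdry m F); let boxEdgesAt : Literature.Probability.LatticeModels.Site 2 → ℕ → Set (Sym2 (Literature.Probability.LatticeModels.Site 2)) := fun c R => {e | e ∈ (Literature.Probability.LatticeModels.zdGraph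 2).edgeSet ∧ ∀ v ∈ e, v - c ∈ Literature.Probability.LatticeModels.box 2 R}; let Rel : ℕ → (m : ℕ) → (Fin m → Literature.Probability.Percolation.QuadCrossing.Quad (Set.univ : Set ℂ)) → ℝ → Literature.Probability.LatticeModels.Site 2 → ℕ → Set (Literature.Probability.Percolation.BondConfig (Literature.Probability.LatticeModels.Site 2)) := fun k m F η u R => {ω | ∃ ω' : Literature.Probability.Percolation.BondConfig (Literature.Probability.LatticeModels.Site 2), (∀ i, i ∉ boxEdgesAt (ctr k u) R → (i ∈ ω' ↔ i ∈ ω)) ∧ ¬ (ω' ∈ Aloc m F η ↔ ω ∈ Aloc m F η)}; ∀ k : ℕ, k = 2 ∨ k = 3 → ∀ γ : unitInterval → ℝ × ℝ, PathOK k γ → ∀ (m : ℕ) (F : Fin m → Literature.Probability.Percolation.QuadCrossing.Quad (Set.univ : Set ℂ)), ∃ b C₀ η₀ : ℝ, 0 < b ∧ 0 < η₀ ∧ ∀ (s : unitInterval), ∀ η ∈ Set.Ioo (0 : ℝ) η₀, ∀ (D : ℕ), 1 ≤ D → ∀ U : Finset (Literature.Probability.LatticeModels.Site 2), ∑ u ∈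 U.filter (fun u => bdist k m F η u < 2 * D * η), (M k (γ s).1 (γ s).2).real (Rel k m F η u D) ≤ C₀ * (D : ℝ) ^ 2 * min 1 (((D : ℝ) * η) ^ b)

/-- the glue item the gate generates for `--split TrivialSectorRate` (route-context rendering). -/
def TrivialSectorRateOfSplit : Prop :=
  BlockAlignment → BoundaryRelevance → TrivialSectorRate

end Summit.CriticalPhenomena.CardyFormulaZ2.Theses.CardySelfRefinement

/-! ## §1 The children in `FarField` vocabulary and the definitional bridges -/

namespace Summit.CriticalPhenomena.CardyFormulaZ2.Theorems.CardySelfRefinement.TrivialSectorRateSplit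

open scoped Classical BigOperators
open Set MeasureTheory Filter
open Literature.Probability.LatticeModels Literature.Probability.Percolation
open Literature.Probability.Percolation.QuadCrossing
open Summit.CriticalPhenomena.CardyFormulaZ2.Theses.CardySelfRefinement
open Summit.CriticalPhenomena.CardyFormulaZ2.Theorems.CardySelfRefinement
open Summit.CriticalPhenomena.CardyFormulaZ2.Theorems.CardySelfRefinement.FarField

/-- **Child 1 — BLOCK ALIGNMENT (the ENGINE)**, `FarField` form: verbatim the registered stub `stub_blockAlignment`. -/
def BlockAlignment : Prop :=
  ∀ k : ℕ, k = 2 ∨ k = 3 → ∀ γ : unitInterval → ℝ × ℝ, PathOK k γ →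
    ∃ κ₁ κ₂ : unitInterval → ℝ, Continuous κ₁ ∧ Continuous κ₂ ∧ (∀ s, κ₁ s ≠ 0 ∨ κ₂ s ≠ 0) ∧
      ∃ (C : ℝ) (R₀ : ℕ), 0 ≤ C ∧ 1 ≤ R₀ ∧
        ∀ (s : unitInterval) (η : ℝ), 0 < η → ∀ (m : ℕ) (F : Fin m → Quad (univ : Set ℂ))
          (u : Site 2) (R : ℕ), R₀ ≤ R → k ∣ R → 4 * η * R < bdist k m F η u →
          |κ₂ s * Tρ k m F η (γ s) u - κ₁ s * Tc k m F η (γ s) u| ≤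
            C / R * (M k (γ s).1 (γ s).2).real (Rel k m F η u k)

/-- **Child 2 — BOUNDARY RELEVANCE (HB)**, `FarField` form: verbatim the registered stub `stub_boundaryRelevance`. -/
def BoundaryRelevance : Prop :=
  ∀ k : ℕ, k = 2 ∨ k = 3 → ∀ γ : unitInterval → ℝ × ℝ, PathOK k γ →
    ∀ (m : ℕ) (F : Fin m → Quad (univ : Set ℂ)),
      ∃ b C₀ η₀ : ℝ, 0 < b ∧ 0 < η₀ ∧ ∀ (s : unitInterval), ∀ η ∈ Set.Ioo (0 : ℝ) η₀, ∀ (D : ℕ), 1 ≤ D →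
        ∀ U : Finset (Site 2),
          ∑ u ∈ U.filter (fun u => bdist k m F η u < 2 * D * η),
            (M k (γ s).1 (γ s).2).real (Rel k m F η u D) ≤ C₀ * (D : ℝ) ^ 2 * min 1 (((D : ℝ) * η) ^ b)

/-- Definitional bridge, child 1: the route-context statement IS the `FarField` form (`δ`/`ζ` only). -/
theorem blockAlignment_iff :
    Summit.CriticalPhenomena.CardyFormulaZ2.Theses.CardySelfRefinement.BlockAlignment ↔ BlockAlignment :=
  Iff.rfl

/-- Definitional bridge, child 2. -/
theorem boundaryRelevance_iff :
    Summit.CriticalPhenomena.CardyFormulaZ2.Theses.CardySelfRefinement.BoundaryRelevance ↔ BoundaryRelevance :=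
  Iff.rfl

/-! ## §2 The composition (skeleton r5 §5b–§5c, lead c2, verbatim; kernel-checked, no `sorry`) -/

/-! ### §5b Per block -/

/-- `|Tρ u| + |Tc u| ≤ Piv u` (triangle inequality on the two orbit sums). -/
theorem abs_Tρ_add_abs_Tc_le_Piv (k m : ℕ) (F : Fin m → Quad (univ : Set ℂ)) (η : ℝ) (q : ℝ × ℝ)
    (u : Site 2) : |Tρ k m F η q u| + |Tc k m F η q u| ≤ Piv k m F η q u := by
  unfold Tρ Tc Piv
  have h1 : |(1 / 2 : ℝ) * ∑ b ∈ bundlesAt u, infl k m F η q (b.1, b.2, (2 : Fin 3))| ≤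
      (1 / 2 : ℝ) * ∑ b ∈ bundlesAt u, |infl k m F η q (b.1, b.2, (2 : Fin 3))| := by
    rw [abs_mul, abs_of_nonneg (by norm_num : (0 : ℝ) ≤ 1 / 2)]
    exact mul_le_mul_of_nonneg_left (Finset.abs_sum_le_sum_abs _ _) (by norm_num)
  have h2 : |(1 / 4 : ℝ) * ∑ t ∈ cellsAt u, ∑ e ∈ interiorEdges k t, infl k m F η q (e.1, e.2, (0 : Fin 3))| ≤
      (1 / 4 : ℝ) * ∑ t ∈ cellsAt u, ∑ e ∈ interiorEdges k t, |infl k m F η q (e.1, e.2, (0 : Fin 3))| := by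
    rw [abs_mul, abs_of_nonneg (by norm_num : (0 : ℝ) ≤ 1 / 4)]
    refine mul_le_mul_of_nonneg_left ?_ (by norm_num)
    refine (Finset.abs_sum_le_sum_abs _ _).trans ?_
    exact Finset.sum_le_sum fun t _ => Finset.abs_sum_le_sum_abs _ _
  linarith

/-- The weight is nonnegative. -/
theorem wt_nonneg (k m : ℕ) (F : Fin m → Quad (univ : Set ℂ)) {η r : ℝ} (hη : 0 < η) (hr : 0 < r)
    (u : Site 2) : 0 ≤ wt k m F η r u := by
  unfold wt
  have : 0 < max (bdist k m F η u) (r * η) := lt_max_of_lt_right (by positivity)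
  positivity

theorem wt_eq_one_of_le (k m : ℕ) (F : Fin m → Quad (univ : Set ℂ)) {η r : ℝ} (hη : 0 < η) (hr : 0 < r)
    {u : Site 2} (h : bdist k m F η u ≤ r * η) : wt k m F η r u = 1 := by
  unfold wt
  rw [max_eq_right h]
  have : (0 : ℝ) < r * η := by positivity
  field_simp

theorem wt_eq_div_of_le (k m : ℕ) (F : Fin m → Quad (univ : Set ℂ)) {η r : ℝ}
    {u : Site 2} (h : r * η ≤ bdist k m F η u) : wt k m F η r u = r * η / bdist k m F η u := by
  unfold wt
  rw [max_eq_left h]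

/-- **Per-block bound (relevance-normalised, radii in `kℕ`; r5: no six-arm term).**  With the engine
data `(κ, C_E, R₀)` and a bound `K` on `|κ₁|, |κ₂|`, every block satisfies
`|κ₂Tρ(u) − κ₁Tc(u)| ≤ (2K(2+2k²) + 2C_E/R₀) · wt(u) · M(Rel u k)` with the contact radius `r = 8kR₀`:
far blocks (`R₀ ≤ farScale u / k`) by the engine at `R = k⌊farScale u / k⌋₊ ∈ kℕ`
(`C_E/R ≤ (2C_E/R₀)·wt u`), contact blocks by `|Tρ| + |Tc| ≤ Piv ≤ (2+2k²)M(Rel u k)` and `wt = 1`. -/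
theorem perBlockR {k : ℕ} (hk : 0 < k) {γ : unitInterval → ℝ × ℝ} {κ₁ κ₂ : unitInterval → ℝ}
    {C K : ℝ} {R₀ : ℕ}
    (hC : 0 ≤ C) (hK : 0 ≤ K) (hK₁ : ∀ s, |κ₁ s| ≤ K) (hK₂ : ∀ s, |κ₂ s| ≤ K) (hR₀ : 1 ≤ R₀)
    (hE : ∀ (s : unitInterval) (η : ℝ), 0 < η → ∀ (m : ℕ) (F : Fin m → Quad (univ : Set ℂ))
      (u : Site 2) (R : ℕ), R₀ ≤ R → k ∣ R → 4 * η * R < bdist k m F η u →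
      |κ₂ s * Tρ k m F η (γ s) u - κ₁ s * Tc k m F η (γ s) u| ≤
        C / R * (M k (γ s).1 (γ s).2).real (Rel k m F η u k))
    (s : unitInterval) {η : ℝ} (hη : 0 < η) (m : ℕ) (F : Fin m → Quad (univ : Set ℂ)) (u : Site 2) :
    |κ₂ s * Tρ k m F η (γ s) u - κ₁ s * Tc k m F η (γ s) u| ≤
      (2 * K * (2 + 2 * (k : ℝ) ^ 2) + 2 * C / R₀) *
        (wt k m F η (8 * k * R₀) u * (M k (γ s).1 (γ s).2).real (Rel k m F η u k)) := by
  have hR₀' : (1 : ℝ) ≤ R₀ := by exact_mod_cast hR₀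
  have hR₀pos : (0 : ℝ) < R₀ := by linarith
  have hk1 : (1 : ℝ) ≤ k := by exact_mod_cast hk
  have hkpos : (0 : ℝ) < k := by linarith
  set Q := (M k (γ s).1 (γ s).2).real (Rel k m F η u k) with hQ
  have hQ0 : 0 ≤ Q := measureReal_nonneg
  have hPivQ : Piv k m F η (γ s) u ≤ (2 + 2 * (k : ℝ) ^ 2) * Q := Piv_le_real_Rel k m hk F η (γ s) u
  have hr : (0 : ℝ) < 8 * k * R₀ := by positivity
  have hwt := wt_nonneg k m F (r := 8 * k * R₀) hη hr u
  set d := bdist k m F η u with hd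
  have hk2 : (0 : ℝ) ≤ 2 + 2 * (k : ℝ) ^ 2 := by positivity
  -- `farScale = d / (8η)`; set `y := farScale / k`
  set y : ℝ := farScale k m F η u / k with hy
  have hyd : y = d / (8 * η * k) := by
    rw [hy, hd]; unfold farScale; rw [div_div]
  have hd_eq : d = 8 * η * k * y := by
    rw [hyd]; field_simp
  by_cases hfar : (R₀ : ℝ) ≤ y
  · -- far block: engine at `R = k ⌊y⌋₊`
    have hy1 : (1 : ℝ) ≤ y := le_trans hR₀' hfar
    have hy0 : (0 : ℝ) ≤ y := by linarith
    set n : ℕ := ⌊y⌋₊ with hn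
    have hnR₀ : R₀ ≤ n := Nat.le_floor hfar
    have hnle : (n : ℝ) ≤ y := Nat.floor_le hy0
    have hnlt : y < (n : ℝ) + 1 := Nat.lt_floor_add_one y
    have hn1 : (1 : ℝ) ≤ n := by exact_mod_cast (le_trans hR₀ hnR₀)
    have hnpos : (0 : ℝ) < n := by linarith
    set R : ℕ := k * n with hR
    have hRR₀ : R₀ ≤ R := le_trans hnR₀ (Nat.le_mul_of_pos_left n hk)
    have hkR : k ∣ R := Dvd.intro n rfl
    have hRreal : (R : ℝ) = k * n := by rw [hR]; push_cast; ring
    have hdist : 4 * η * (R : ℝ) < bdist k m F η u := by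
      rw [← hd, hd_eq, hRreal]
      have : 4 * η * ((k : ℝ) * n) ≤ 4 * η * (k * y) := by gcongr
      nlinarith [mul_pos (mul_pos hη hkpos) hnpos]
    have key := hE s η hη m F u R hRR₀ hkR hdist
    -- the weight on a far block
    have hdle : 8 * (k : ℝ) * R₀ * η ≤ d := by
      rw [hd_eq]; nlinarith [mul_pos (mul_pos hη hkpos) hR₀pos]
    have hwt_eq : wt k m F η (8 * k * R₀) u = 8 * k * R₀ * η / d := by
      rw [hd]; exact wt_eq_div_of_le k m F (by rw [← hd]; exact hdle)
    -- `C / R ≤ (2C/R₀) · wt`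
    have hcoef : C / (R : ℝ) ≤ (2 * C / R₀) * wt k m F η (8 * k * R₀) u := by
      rw [hwt_eq, hd_eq, hRreal, div_le_iff₀ (by positivity)]
      have h2n : y ≤ 2 * (n : ℝ) := by linarith
      have : 2 * C / ↑R₀ * (8 * ↑k * ↑R₀ * η / (8 * η * ↑k * y)) = 2 * C / y := by
        field_simp
      rw [this, div_mul_eq_mul_div, le_div_iff₀ (by linarith)]
      have hkn : C * y ≤ C * (2 * n) := mul_le_mul_of_nonneg_left h2n hC
      nlinarith [mul_nonneg hC hnpos.le, hk1]
    calc |κ₂ s * Tρ k m F η (γ s) u - κ₁ s * Tc k m F η (γ s) u|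
        ≤ C / R * Q := key
      _ ≤ (2 * C / R₀) * wt k m F η (8 * k * R₀) u * Q := by
          gcongr
      _ ≤ (2 * K * (2 + 2 * (k : ℝ) ^ 2) + 2 * C / R₀) * (wt k m F η (8 * k * R₀) u * Q) := by
          have : 0 ≤ 2 * K * (2 + 2 * (k : ℝ) ^ 2) * (wt k m F η (8 * k * R₀) u * Q) := by positivity
          nlinarith
  · -- contact block: trivial bound, weight `1`
    have hylt : y < R₀ := lt_of_not_ge hfar
    have hdle : d ≤ 8 * k * R₀ * η := by
      rw [hd_eq]
      have := mul_lt_mul_of_pos_left hylt (show (0 : ℝ) < 8 * η * k by positivity)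
      nlinarith
    have hwt1 : wt k m F η (8 * k * R₀) u = 1 :=
      wt_eq_one_of_le k m F hη hr (by rw [← hd]; exact hdle)
    rw [hwt1, one_mul]
    have h1 : |κ₂ s * Tρ k m F η (γ s) u - κ₁ s * Tc k m F η (γ s) u| ≤
        K * (|Tρ k m F η (γ s) u| + |Tc k m F η (γ s) u|) := by
      calc |κ₂ s * Tρ k m F η (γ s) u - κ₁ s * Tc k m F η (γ s) u|
          ≤ |κ₂ s * Tρ k m F η (γ s) u| + |κ₁ s * Tc k m F η (γ s) u| := abs_sub _ _
        _ = |κ₂ s| * |Tρ k m F η (γ s) u| + |κ₁ s| * |Tc k m F η (γ s) u| := by rw [abs_mul, abs_mul]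
        _ ≤ K * |Tρ k m F η (γ s) u| + K * |Tc k m F η (γ s) u| := by
            gcongr
            · exact hK₂ s
            · exact hK₁ s
        _ = K * (|Tρ k m F η (γ s) u| + |Tc k m F η (γ s) u|) := by ring
    have h2 := abs_Tρ_add_abs_Tc_le_Piv k m F η (γ s) u
    have h3 : K * (|Tρ k m F η (γ s) u| + |Tc k m F η (γ s) u|) ≤ K * ((2 + 2 * (k : ℝ) ^ 2) * Q) :=
      mul_le_mul_of_nonneg_left (h2.trans hPivQ) hK
    have h4 : K * ((2 + 2 * (k : ℝ) ^ 2) * Q) ≤ (2 * K * (2 + 2 * (k : ℝ) ^ 2) + 2 * C / R₀) * Q := by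
      have : 0 ≤ (K * (2 + 2 * (k : ℝ) ^ 2) + 2 * C / R₀) * Q := by positivity
      nlinarith
    linarith

/-! ### §5c The crux -/

/-- **`TrivialSectorRate_of`** — the registered stubs (block alignment = the engine, boundary relevance
OPEN; Russo–orbit, four arms, far-field factorisation PROVED) imply the crux BY NAME; the PROVED stubs
and the proved mass theorem are discharged inside or passed by name.  For `k`, an RSW path `γ` and a
quad family `F`: the engine gives `κ, C_E, R₀`; bound `|κ|` by `K` on the compact parameter interval; take
the relevance mass data `(a, C_M, η_M)` at contact radius `8kR₀` (`weightedRelevanceMass_of_factorisation`);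
then `θ := a`, `η₀ := η_M`, and at every `(s, η)` Russo–orbit gives
`κ₂∂ρP − κ₁∂cP = Σ_u (κ₂Tρ(u) − κ₁Tc(u))` over a finite block set, each term bounded by `perBlockR`;
summing, `|κ₂∂ρP − κ₁∂cP| ≤ (2K(2+2k²) + 2C_E/R₀)·C_M η^a`. -/
theorem TrivialSectorRate_of (h2 : BlockAlignment) (hB : BoundaryRelevance) :
    Summit.CriticalPhenomena.CardyFormulaZ2.Theses.CardySelfRefinement.TrivialSectorRate := by
  -- the PROVED inputs of the line (tree theorems): Russo–orbit, four arms above one, far-field factorisation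
  have h1 := FarField.stub_russoOrbit
  have h3 := FarField.stub_fourArmAboveOne
  have hT := FarField.stub_farFieldFactorisation
  rw [trivialSectorRate_iff]
  intro k hk γ hγ m F
  have hk0 : 0 < k := by rcases hk with rfl | rfl <;> norm_num
  -- the engine
  obtain ⟨κ₁, κ₂, hκ₁, hκ₂, hnv, C, R₀, hC, hR₀, hE⟩ := h2 k hk γ hγ
  -- a uniform bound on `|κ₁|, |κ₂|` over the compact parameter interval
  obtain ⟨K₁, hK₁⟩ := isCompact_univ.exists_bound_of_continuousOn (hκ₁.continuousOn (s := Set.univ))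
  obtain ⟨K₂, hK₂⟩ := isCompact_univ.exists_bound_of_continuousOn (hκ₂.continuousOn (s := Set.univ))
  set K : ℝ := max (max K₁ K₂) 0 with hKdef
  have hK0 : 0 ≤ K := le_max_right _ _
  have hK₁' : ∀ s, |κ₁ s| ≤ K := fun s =>
    le_trans (by simpa [Real.norm_eq_abs] using hK₁ s (Set.mem_univ s)) (le_trans (le_max_left _ _) (le_max_left _ _))
  have hK₂' : ∀ s, |κ₂ s| ≤ K := fun s =>
    le_trans (by simpa [Real.norm_eq_abs] using hK₂ s (Set.mem_univ s)) (le_trans (le_max_right _ _) (le_max_left _ _))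
  -- mass data at contact radius `8kR₀`
  have hR₀' : (1 : ℝ) ≤ R₀ := by exact_mod_cast hR₀
  have hkpos : (0 : ℝ) < k := by exact_mod_cast hk0
  have hr : (0 : ℝ) < 8 * k * R₀ := by positivity
  obtain ⟨a, CM, ηM, ha, hCM, hηM, hMass⟩ :=
    weightedRelevanceMass_of_factorisation hk0 (h3 k hk γ hγ) (hB k hk γ hγ m F) (hT k hk γ m F)
      (8 * k * R₀) hr
  -- the answer
  set A : ℝ := 2 * K * (2 + 2 * (k : ℝ) ^ 2) + 2 * C / R₀ with hAdef
  have hA0 : 0 ≤ A := by positivity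
  refine ⟨a, ha, κ₁, κ₂, hκ₁, hκ₂, hnv, A * CM, ηM, hηM, ?_⟩
  intro s η hη
  have hη0 : 0 < η := hη.1
  -- Russo–orbit at the parameter point `γ s ∈ [0,1]²`
  have hq : γ s ∈ Set.Icc (0 : ℝ) 1 ×ˢ Set.Icc (0 : ℝ) 1 := hγ.2.2.2.1 s
  obtain ⟨U, hUρ, hUc⟩ := h1 k hk (γ s) hq η hη0 m F
  have hsum : κ₂ s * Dρ k m F η (γ s) - κ₁ s * Dc k m F η (γ s) =
      ∑ u ∈ U, (κ₂ s * Tρ k m F η (γ s) u - κ₁ s * Tc k m F η (γ s) u) := by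
    rw [hUρ, hUc, Finset.mul_sum, Finset.mul_sum, ← Finset.sum_sub_distrib]
  rw [hsum]
  -- per-block bounds, summed
  have hblock := fun u => perBlockR (k := k) (γ := γ) hk0 hC hK0 hK₁' hK₂' hR₀ hE s hη0 m F u
  have hle := (Finset.abs_sum_le_sum_abs _ U).trans (Finset.sum_le_sum fun u _ => hblock u)
  rw [← Finset.mul_sum] at hle
  -- the mass bound
  have hM := hMass s η hη U
  have hA : A * ∑ u ∈ U, wt k m F η (8 * k * R₀) u * (M k (γ s).1 (γ s).2).real (Rel k m F η u k) ≤
      A * (CM * η ^ a) := mul_le_mul_of_nonneg_left hM hA0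
  calc |∑ u ∈ U, (κ₂ s * Tρ k m F η (γ s) u - κ₁ s * Tc k m F η (γ s) u)|
      ≤ A * ∑ u ∈ U, wt k m F η (8 * k * R₀) u * (M k (γ s).1 (γ s).2).real (Rel k m F η u k) := hle
    _ ≤ A * (CM * η ^ a) := hA
    _ = (A * CM) * η ^ a := by ring


/-! ## §3 The glue over the ROUTE decls -/

/-- **GLUE of the split** — `BlockAlignment → BoundaryRelevance → TrivialSectorRate` over the route-context children
(they unfold to the `FarField` forms definitionally). -/
theorem TrivialSectorRate_of_subs :
    Summit.CriticalPhenomena.CardyFormulaZ2.Theses.CardySelfRefinement.BlockAlignment →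
      Summit.CriticalPhenomena.CardyFormulaZ2.Theses.CardySelfRefinement.BoundaryRelevance →
        Summit.CriticalPhenomena.CardyFormulaZ2.Theses.CardySelfRefinement.TrivialSectorRate :=
  fun h2 hB => TrivialSectorRate_of (blockAlignment_iff.1 h2) (boundaryRelevance_iff.1 hB)

/-- The glue item, closed (after landing: this is the `_proof` theorem of `TrivialSectorRateOfSplit`). -/
theorem trivialSectorRateOfSplit_proof :
    Summit.CriticalPhenomena.CardyFormulaZ2.Theses.CardySelfRefinement.TrivialSectorRateOfSplit :=
  TrivialSectorRate_of_subs

end Summit.CriticalPhenomena.CardyFormulaZ2.Theorems.CardySelfRefinement.TrivialSectorRateSplit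

end
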